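import Mathlib
import Summits.NavierStokesRegularity.NavierStokesRegularity.Theorems.FilamentSkeletonRssStadiumVerticalDisplacement
import Summits.NavierStokesRegularity.NavierStokesRegularity.Theorems.FilamentSkeletonRssStadiumKernelPieces
import Summits.NavierStokesRegularity.NavierStokesRegularity.Theorems.FilamentSkeletonRssStadiumTangentModulus
import Summits.NavierStokesRegularity.NavierStokesRegularity.Theorems.FilamentSkeletonRssStadiumPairPositivity
import Summits.NavierStokesRegularity.NavierStokesRegularity.Theorems.FilamentSkeletonRssStadiumDeviationPackage

/-!
# The OWN-filament FAR kernel at a REAL source (`TangentSkeletonNearStraightL`, stmt-NavierStokesRegularity-23320, registered stub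
# `stub_stripPropagation` — the unshifted real part of the own-filament contour beyond its foot)

Target `z = x + iy` in the stadium `S` of filament `X` (holomorphic extension `F`, `F = cplx ∘ X` on the trace, `‖F′‖ ≤ 2`), REAL source
`X(σ)` of the SAME filament at chord distance `d = ‖X(x) − X(σ)‖ ≥ 12|y|` (with the near-straight chord `≥ (7/8)|x − σ|` this is `|x − σ| ≥ 13.8|y|` —
what the `cs√Γ/16` retype provides beyond the contour foot, see evidence `DIAG-stripPropagation-ends-g2.md` on 23320; the quarter-width
`Theorems.StadiumFarKernelBound` needs `d ≥ 16|y|`).  Then (`own_far_pointwise`):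
  `Re(Σᵢ (Fᵢ(z) − Xᵢ(σ))² + κA) ≥ d²/3`, and `‖((·)^{3/2})⁻¹ • (X′(σ) ⨯₃ (F(z) − X(σ)))‖ ≤ (d²/3)^{−3/2}·(2·(d + 2|y|))`,
via the vertical displacement `‖F(z) − F(x)‖ ≤ 2|y|` (Theorems.StadiumVerticalDisplacement.re_sum_sq_sub_ge_of_vertical), `Σ|uᵢ| ≤ √3‖u‖`,
`√3 ≤ 7/4`, the principal-branch modulus `‖(w^{3/2})⁻¹‖ ≤ (Re w)^{−3/2}` and `‖t ⨯₃ v‖ ≤ 2‖t‖‖v‖` (Theorems.StadiumKernelPieces).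
HONEST FRAMING: a tool for a HYPOTHETICAL filament skeleton on the NEGATIVE side of a MODEL route; nothing here bears on Navier–Stokes regularity
or blow-up.  `--supports stmt-NavierStokesRegularity-23320`.
-/

set_option linter.dupNamespace false

noncomputable section

namespace Summit.NavierStokesRegularity.NavierStokesRegularity.Theorems.StadiumOwnFarKernel

open Set Metric
open scoped InnerProductSpace Matrix
open Summit.NavierStokesRegularity.NavierStokesRegularity.Theorems.StadiumVerticalDisplacement
open Summit.NavierStokesRegularity.NavierStokesRegularity.Theorems.StadiumKernelPieces
open Summit.NavierStokesRegularity.NavierStokesRegularity.Theorems.StadiumTangentModulus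
open Summit.NavierStokesRegularity.NavierStokesRegularity.Theorems.StadiumPairPositivity
open Summit.NavierStokesRegularity.NavierStokesRegularity.Theorems.StadiumDeviationPackage

/-- `√3 ≤ 7/4`. [folklore] -/
theorem sqrt_three_le : √(3:ℝ) ≤ 7 / 4 := by
  rw [show (7 / 4 : ℝ) = √((7 / 4) ^ 2) by rw [Real.sqrt_sq (by norm_num)]]
  exact Real.sqrt_le_sqrt (by norm_num)

/-- `Σᵢ |vᵢ| ≤ √3·‖v‖` for `v ∈ ℝ³`. [folklore] -/
theorem sum_abs_le_sqrt_three_mul_norm (v : EuclideanSpace ℝ (Fin 3)) : ∑ i, |v i| ≤ √3 * ‖v‖ := by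
  have h := sum_mul_le_sqrt_mul_sqrt (fun _ => (1:ℝ)) (fun i => |v i|)
  have h1 : ∑ i : Fin 3, (fun _ => (1:ℝ)) i ^ 2 = 3 := by simp
  have h2 : ∑ i : Fin 3, (fun i => |v i|) i ^ 2 = ‖v‖ ^ 2 := by
    simp only [sq_abs]
    rw [EuclideanSpace.norm_eq, Real.sq_sqrt (Finset.sum_nonneg fun i _ => sq_nonneg _)]
    simp [Real.norm_eq_abs, sq_abs]
  rw [h1, h2, Real.sqrt_sq (norm_nonneg _)] at h
  simpa using h

/-- **Own-filament far kernel at a real source.**  See the module docstring. [folklore] -/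
theorem own_far_pointwise {hs L cc κ : ℝ} {F : ℂ → (Fin 3 → ℂ)}
    (hF : DifferentiableOn ℂ F {z : ℂ | |z.im| < hs ∧ |z.re - cc| < L + hs})
    (hM : ∀ z ∈ {z : ℂ | |z.im| < hs ∧ |z.re - cc| < L + hs}, ‖deriv F z‖ ≤ 2)
    {X : ℝ → EuclideanSpace ℝ (Fin 3)} (hXu : ∀ τ, ‖deriv X τ‖ = 1)
    (hFX : ∀ r : ℝ, (r : ℂ) ∈ {z : ℂ | |z.im| < hs ∧ |z.re - cc| < L + hs} →
      F r = fun i => ((⟪X r, EuclideanSpace.single i (1:ℝ)⟫_ℝ : ℝ) : ℂ))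
    {A : ℝ} (hκA : 0 ≤ κ * A) {z : ℂ} (hz : z ∈ {z : ℂ | |z.im| < hs ∧ |z.re - cc| < L + hs}) (σ : ℝ)
    (hdpos : 0 < ‖X z.re - X σ‖) (hfar : 12 * |z.im| ≤ ‖X z.re - X σ‖) :
    ‖X z.re - X σ‖ ^ 2 / 3 ≤ ((∑ i, (F z i - ((X σ i : ℝ) : ℂ)) ^ 2) + ((κ * A : ℝ) : ℂ)).re ∧
    ‖(((∑ i, (F z i - ((X σ i : ℝ) : ℂ)) ^ 2) + ((κ * A : ℝ) : ℂ)) ^ ((3:ℂ) / 2))⁻¹ •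
        ((fun i => ((deriv X σ i : ℝ) : ℂ)) ⨯₃ (fun i => F z i - ((X σ i : ℝ) : ℂ)))‖ ≤
      (‖X z.re - X σ‖ ^ 2 / 3) ^ (-(3/2 : ℝ)) * (2 * (‖X z.re - X σ‖ + 2 * |z.im|)) := by
  set S : Set ℂ := {z : ℂ | |z.im| < hs ∧ |z.re - cc| < L + hs} with hS
  have hSo : IsOpen S := by
    have h1 : IsOpen {z : ℂ | |z.im| < hs} := isOpen_lt (continuous_abs.comp Complex.continuous_im) continuous_const
    have h2 : IsOpen {z : ℂ | |z.re - cc| < L + hs} :=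
      isOpen_lt (continuous_abs.comp (Complex.continuous_re.sub continuous_const)) continuous_const
    exact h1.inter h2
  set d : ℝ := ‖X z.re - X σ‖ with hd
  have hzim : |z.im| < hs := hz.1
  have hzre : |z.re - cc| < L + hs := hz.2
  have hhs : 0 < hs := lt_of_le_of_lt (abs_nonneg _) hzim
  -- the vertical segment and the real foot
  have hseg : ∀ t ∈ Set.uIcc 0 z.im, ((z.re : ℝ) : ℂ) + (t : ℂ) * Complex.I ∈ S := by
    intro t ht
    refine ⟨?_, by simpa using hzre⟩
    have ht' : |t| ≤ |z.im| := by
      rcases le_total 0 z.im with hu | hu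
      · rw [uIcc_of_le hu] at ht
        rw [abs_of_nonneg ht.1, abs_of_nonneg hu]; exact ht.2
      · rw [uIcc_of_ge hu] at ht
        rw [abs_of_nonpos ht.2, abs_of_nonpos hu]; linarith [ht.1]
    have : ((((z.re : ℝ) : ℂ) + (t : ℂ) * Complex.I).im) = t := by simp
    rw [this]; linarith
  have hxS : ((z.re : ℝ) : ℂ) ∈ S := ⟨by simpa using hhs, by simpa using hzre⟩
  have hFx : F (z.re : ℝ) = fun i => ((X z.re i : ℝ) : ℂ) := by
    rw [hFX _ hxS]; funext i; rw [inner_single_eq]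
  have hzeq : ((z.re : ℝ) : ℂ) + ((z.im : ℝ) : ℂ) * Complex.I = z := Complex.re_add_im z
  -- (1) the real part of the base
  have hre0 := re_sum_sq_sub_ge_of_vertical hSo hF hM hseg hFx (X σ)
  rw [hzeq] at hre0
  have hsum_abs : ∑ i, |X z.re i - X σ i| ≤ √3 * d := by
    have h := sum_abs_le_sqrt_three_mul_norm (X z.re - X σ)
    simpa [PiLp.sub_apply] using h
  have h3 := sqrt_three_le
  have hy0 : 0 ≤ |z.im| := abs_nonneg _
  have hre1 : d ^ 2 / 3 ≤ (∑ i, (F z i - ((X σ i : ℝ) : ℂ)) ^ 2).re := by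
    have hstep : d ^ 2 - 2 * (2 * |z.im|) * (√3 * d) - 3 * (2 * |z.im|) ^ 2 ≤
        (∑ i, (F z i - ((X σ i : ℝ) : ℂ)) ^ 2).re := by
      have hmono : d ^ 2 - 2 * (2 * |z.im|) * (√3 * d) - 3 * (2 * |z.im|) ^ 2 ≤
          d ^ 2 - 2 * (2 * |z.im|) * (∑ i, |X z.re i - X σ i|) - 3 * (2 * |z.im|) ^ 2 := by
        nlinarith [hsum_abs, hy0]
      exact hmono.trans hre0
    have e1 : √3 * (|z.im| * d) ≤ 7 / 4 * (|z.im| * d) := mul_le_mul_of_nonneg_right h3 (by positivity)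
    have e2 : |z.im| * d ≤ d * d / 12 := by nlinarith [hfar, hdpos.le]
    have e3 : 144 * (|z.im| * |z.im|) ≤ d * d := by nlinarith [hfar, hy0]
    have e4 : d ^ 2 - 2 * (2 * |z.im|) * (√3 * d) - 3 * (2 * |z.im|) ^ 2 =
        d * d - 4 * (√3 * (|z.im| * d)) - 12 * (|z.im| * |z.im|) := by ring
    rw [e4] at hstep
    have e5 : d ^ 2 / 3 = d * d / 3 := by ring
    rw [e5]
    linarith
  have hbase_re : ((∑ i, (F z i - ((X σ i : ℝ) : ℂ)) ^ 2) + ((κ * A : ℝ) : ℂ)).re =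
      (∑ i, (F z i - ((X σ i : ℝ) : ℂ)) ^ 2).re + κ * A := by
    rw [Complex.add_re, Complex.ofReal_re]
  have hre2 : d ^ 2 / 3 ≤ ((∑ i, (F z i - ((X σ i : ℝ) : ℂ)) ^ 2) + ((κ * A : ℝ) : ℂ)).re := by
    rw [hbase_re]; linarith
  refine ⟨hre2, ?_⟩
  -- (2) the kernel norm
  set w : ℂ := (∑ i, (F z i - ((X σ i : ℝ) : ℂ)) ^ 2) + ((κ * A : ℝ) : ℂ) with hw
  have hm0 : 0 < d ^ 2 / 3 := by positivity
  have hwpos : 0 < w.re := lt_of_lt_of_le hm0 hre2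
  have hker : ‖(w ^ ((3:ℂ) / 2))⁻¹‖ ≤ (d ^ 2 / 3) ^ (-(3/2 : ℝ)) :=
    (norm_inv_cpow_threeHalves_le hwpos).trans (Real.rpow_le_rpow_of_nonpos hm0 hre2 (by norm_num))
  -- numerator
  have ht : ‖(fun i => ((deriv X σ i : ℝ) : ℂ))‖ ≤ 1 := by
    have h := norm_cplx_le (deriv X σ)
    have e1 : (fun i => ((⟪deriv X σ, EuclideanSpace.single i (1:ℝ)⟫_ℝ : ℝ) : ℂ)) = fun i => ((deriv X σ i : ℝ) : ℂ) := by
      funext i; rw [inner_single_eq]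
    rw [e1, hXu σ] at h
    exact h
  have hv : ‖(fun i => F z i - ((X σ i : ℝ) : ℂ))‖ ≤ d + 2 * |z.im| := by
    have hsplit : (fun i => F z i - ((X σ i : ℝ) : ℂ)) =
        (fun i => (((X z.re - X σ) i : ℝ) : ℂ)) + (F z - F (z.re : ℝ)) := by
      funext i
      simp only [Pi.add_apply, Pi.sub_apply, hFx, PiLp.sub_apply, Complex.ofReal_sub]
      ring
    rw [hsplit]
    have h1 : ‖(fun i => (((X z.re - X σ) i : ℝ) : ℂ))‖ ≤ d := by
      have h := norm_cplx_le (X z.re - X σ)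
      have e1 : (fun i => ((⟪X z.re - X σ, EuclideanSpace.single i (1:ℝ)⟫_ℝ : ℝ) : ℂ)) =
          fun i => (((X z.re - X σ) i : ℝ) : ℂ) := by
        funext i; rw [inner_single_eq]
      rw [e1] at h
      exact h
    have h2 : ‖F z - F (z.re : ℝ)‖ ≤ 2 * |z.im| := by
      have h := norm_sub_le_of_vertical_segment hSo hF hM hseg
      rw [hzeq] at h
      exact h
    exact (norm_add_le _ _).trans (add_le_add h1 h2)
  have hnum : ‖(fun i => ((deriv X σ i : ℝ) : ℂ)) ⨯₃ (fun i => F z i - ((X σ i : ℝ) : ℂ))‖ ≤ 2 * (d + 2 * |z.im|) := by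
    have h := norm_crossProduct_le (fun i => ((deriv X σ i : ℝ) : ℂ)) (fun i => F z i - ((X σ i : ℝ) : ℂ))
    have h0 : 0 ≤ d + 2 * |z.im| := by positivity
    calc _ ≤ 2 * ‖(fun i => ((deriv X σ i : ℝ) : ℂ))‖ * ‖(fun i => F z i - ((X σ i : ℝ) : ℂ))‖ := h
      _ ≤ 2 * 1 * (d + 2 * |z.im|) := by
          apply mul_le_mul (mul_le_mul_of_nonneg_left ht (by norm_num)) hv (norm_nonneg _) (by norm_num)
      _ = 2 * (d + 2 * |z.im|) := by ring
  rw [norm_smul]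
  exact mul_le_mul hker hnum (norm_nonneg _) (Real.rpow_nonneg hm0.le _)

end Summit.NavierStokesRegularity.NavierStokesRegularity.Theorems.StadiumOwnFarKernel

end
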